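import Summits.Parity.GeneralizedHardyLittlewood.Theorems.PrimeLevelFamEdgeMomentsBeyondDiagonalDiagDecorPrimeSqTerm
import HarnessLib

/-!
# Route `PrimeLevelFamEdge`, crux K_A `MomentsBeyondDiagonal` (stmt-Parity-20007), line «petersson_layers» v4, stub `stub_diag`:
# **termwise bounds for the prime sum of inner coprime sums with a GENERAL prime-log power `log^{i+1}p`**
# (the `P_{i+1} = Σ_{p∣k}log^{i+1}p`-decorations; `i = 1` is `…DiagDecorPrimeSqTerm`)

Second brick of the `M₄`-engine asked for by rung 2 of `stub_diag` (`…DiagRungTwoOfM4`; census note in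
`…DiagDecorOrderTwoTwoAssembly`): the `P₄ = Σ_{p∣k}log⁴p`-decorated coprime Selberg sum
`Σ_{k≤y,(k,n)=1}τ(k)W(k)P₄(k)logᶜ(y/k) = Σ_{p≤y}log⁴p·a_n(p)·S⁽ᶜ⁾(y/p; np)` (`…DiagDecorPrime.sum_copTauW_mul_mul_sum_primeFactors_eq`
with `g(p) = log⁴p`) is evaluated termwise exactly as the `P₂`-sum was, the weight `log²p` replaced by `log^{i+1}p`:

* `abs_primePow_term_sub_le` — `c ≥ 3`: `|[p prime]·log^{i+1}p·a_n(p)·S⁽ᶜ⁾(y/p;np) + 2c(c−1)E_n·v(p)·log^ip·log^{c−2}(y/p)|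
  ≤ [p prime, p∤n]·(log p/(p+1))·4C·D(n)(1+log y)^{c−3}log^iy` (`v(p) = log p/(p−1)`);
* `abs_primePow_term_two_sub_le` — `c = 2`: `|[p prime]·log^{i+1}p·a_n(p)·S⁽²⁾(y/p;np) + 4E_n·v(p)·log^ip|
  ≤ [p prime]log p/(p(1+log(y/p))²)·4C·D(n)·log^iy`.

Summing over `p ≤ y` against the Mertens moments of `…DiagPrimeSumLogPow` (`Σ_{p∤n}v(p)log^jp·logᵃ(y/p) =
(j!a!/(a+j+1)!)log^{a+j+1}y + O`) gives the `P_{i+1}`-decorated coprime sums (next brick). Def-free; theorems only.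
Helper `--supports stmt-Parity-20007`; closes nothing; K_A, K_B and the Parity summit are NOT proved; nothing about
Landau–Siegel zeros.

## References
* E. Kowalski, P. Michel, J. VanderKam, J. reine angew. Math. 526 (2000), (23)–(28) pp. 13–15 and Prop. 5.1 p. 18.
  [cite: KowalskiMichelVanderKam2000, (23)–(28) — derivation (prime-power-log decorations of the Selberg coordinates)]
-/

noncomputable section

open scoped Real
open Finset ArithmeticFunction

namespace Summit.Parity.GeneralizedHardyLittlewood.Theorems.MomentsBeyondDiagonal.DiagKernel

open Literature.NumberTheory.LFunctions Literature.NumberTheory.LFunctions.KMV2000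
open SelbergCoord (kappa)
open Summit.Parity.GeneralizedHardyLittlewood.Theorems.BeyondDiagonalBeatsQuarter.KernelFormXSq
  (copTauW copTauW_apply_prime mainConst divWeight divWeight_nonneg mainConst_nonneg divWeight_prime_mul_le coprimeSum)

/-- Termwise bound with a prime-log power `log^{i+1}p`, `c ≥ 3`: with `C` the constant of `…DiagCoprime.abs_coprimeSumPow_sub_le`,
for `p ≤ y`: `|[p prime]·log^{i+1}p·a_n(p)·S⁽ᶜ⁾(y/p;np) + 2c(c−1)E_n·v(p)·log^i p·log^{c−2}(y/p)| ≤
[p prime, p∤n]·(log p/(p+1))·4C·D(n)(1+log y)^{c−3}log^i y` (`v(p) = log p/(p−1)`; `i = 1` is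
`…DiagDecorPrimeSqTerm.abs_primeSq_term_sub_le`). [cite: KowalskiMichelVanderKam2000, (23)–(28) — derivation] -/
theorem abs_primePow_term_sub_le (i : ℕ) {c : ℕ} {C : ℝ} (hC0 : 0 ≤ C)
    (hC : ∀ n : ℕ, n ≠ 0 → ∀ y : ℝ, 1 ≤ y →
      |∑ k ∈ Icc 1 ⌊y⌋₊, copTauW n k * Real.log (y / k) ^ c -
          (c : ℝ) * ((c : ℝ) - 1) * mainConst n * Real.log y ^ (c - 2)| ≤
        C * divWeight n * (1 + Real.log y) ^ (c - 3))
    {n : ℕ} (hn : n ≠ 0) {y : ℝ} (hy : 1 ≤ y) {p : ℕ} (hp : p ∈ Icc 1 ⌊y⌋₊) :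
    |(if p.Prime then Real.log p ^ (i + 1) * copTauW n p *
          ∑ k ∈ Icc 1 (⌊y⌋₊ / p), copTauW (n * p) k * Real.log (y / ((p * k : ℕ) : ℝ)) ^ c else 0) -
        (-2 * ((c : ℝ) * ((c : ℝ) - 1)) * mainConst n) *
          ((if p.Prime ∧ ¬ p ∣ n then Real.log p / ((p : ℝ) - 1) else 0) *
            (Real.log p ^ i * Real.log (y / p) ^ (c - 2)))| ≤
      if p.Prime ∧ ¬ p ∣ n then
        Real.log p / ((p : ℝ) + 1) * (4 * C * divWeight n * (1 + Real.log y) ^ (c - 3) * Real.log y ^ i) else 0 := by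
  obtain ⟨hp0, hpy, hyp1, hlp0, hlpy, hL0, hLy⟩ := prime_range_facts hy hp
  have hD := divWeight_nonneg n
  have hly : 0 ≤ Real.log y := Real.log_nonneg hy
  by_cases hpr : p.Prime
  · by_cases hpn : p ∣ n
    · have h0 : copTauW n p = 0 := by rw [copTauW_apply_prime hpr, if_pos hpn]
      have hneg : ¬ (p.Prime ∧ ¬ p ∣ n) := fun h ↦ h.2 hpn
      rw [if_pos hpr, if_neg hneg, if_neg hneg, h0]
      simp
    · have hpos : p.Prime ∧ ¬ p ∣ n := ⟨hpr, hpn⟩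
      rw [if_pos hpr, if_pos hpos, if_pos hpos, copTauW_apply_prime hpr, if_neg hpn,
        sum_copTauW_mul_log_div_mul_pow_eq]
      have hnp : n * p ≠ 0 := mul_ne_zero hn hpr.ne_zero
      have hin := hC (n * p) hnp (y / p) hyp1
      set S := ∑ k ∈ Icc 1 ⌊y / p⌋₊, copTauW (n * p) k * Real.log (y / p / k) ^ c with hS
      set err := S - (c : ℝ) * ((c : ℝ) - 1) * mainConst (n * p) * Real.log (y / p) ^ (c - 2) with herr
      -- the size of the inner error
      have hDnp : divWeight (n * p) ≤ 2 * divWeight n := by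
        rw [mul_comm]; exact divWeight_prime_mul_le hpr hn
      have hpow : (1 + Real.log (y / p)) ^ (c - 3) ≤ (1 + Real.log y) ^ (c - 3) :=
        pow_le_pow_left₀ (by linarith) (by linarith) _
      have herr_le : |err| ≤ 2 * C * divWeight n * (1 + Real.log y) ^ (c - 3) := by
        calc |err| ≤ C * divWeight (n * p) * (1 + Real.log (y / p)) ^ (c - 3) := hin
          _ ≤ C * (2 * divWeight n) * (1 + Real.log y) ^ (c - 3) := by
              gcongr
          _ = 2 * C * divWeight n * (1 + Real.log y) ^ (c - 3) := by ring
      -- the main parts cancel by the prime weight transfer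
      have hE := log_div_succ_mul_mainConst_mul hn hpr hpn
      have hp1 : (p : ℝ) + 1 ≠ 0 := by linarith
      have hSe : S = (c : ℝ) * ((c : ℝ) - 1) * mainConst (n * p) * Real.log (y / p) ^ (c - 2) + err := by
        rw [herr]; ring
      have hkey : Real.log p ^ (i + 1) * (-2 * ((p : ℝ) + 1)⁻¹) * S -
          (-2 * ((c : ℝ) * ((c : ℝ) - 1)) * mainConst n) *
            (Real.log p / ((p : ℝ) - 1) * (Real.log p ^ i * Real.log (y / p) ^ (c - 2))) =
          Real.log p ^ (i + 1) * (-2 * ((p : ℝ) + 1)⁻¹) * err := by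
        have hE' : mainConst n * (Real.log p / ((p : ℝ) - 1)) = Real.log p * ((p : ℝ) + 1)⁻¹ * mainConst (n * p) := by
          rw [← hE]; rw [div_eq_mul_inv]
        calc _ = Real.log p ^ (i + 1) * (-2 * ((p : ℝ) + 1)⁻¹) * S +
              2 * ((c : ℝ) * ((c : ℝ) - 1)) * (mainConst n * (Real.log p / ((p : ℝ) - 1))) *
                (Real.log p ^ i * Real.log (y / p) ^ (c - 2)) := by ring
          _ = _ := by rw [hE', hSe]; ring
      rw [hkey, abs_mul, abs_mul, abs_of_nonneg (pow_nonneg hlp0 (i + 1))]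
      have habs2 : |(-2 : ℝ) * ((p : ℝ) + 1)⁻¹| = 2 * ((p : ℝ) + 1)⁻¹ := by
        rw [abs_mul, abs_inv, abs_of_pos (by linarith : (0 : ℝ) < (p : ℝ) + 1)]
        norm_num
      rw [habs2]
      calc Real.log p ^ (i + 1) * (2 * ((p : ℝ) + 1)⁻¹) * |err|
          ≤ Real.log p ^ (i + 1) * (2 * ((p : ℝ) + 1)⁻¹) * (2 * C * divWeight n * (1 + Real.log y) ^ (c - 3)) :=
            mul_le_mul_of_nonneg_left herr_le (by positivity)
        _ = Real.log p / ((p : ℝ) + 1) * (4 * C * divWeight n * (1 + Real.log y) ^ (c - 3) * Real.log p ^ i) := by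
            rw [div_eq_mul_inv]; ring
        _ ≤ Real.log p / ((p : ℝ) + 1) * (4 * C * divWeight n * (1 + Real.log y) ^ (c - 3) * Real.log y ^ i) := by
            gcongr
  · have hneg : ¬ (p.Prime ∧ ¬ p ∣ n) := fun h ↦ hpr h.1
    rw [if_neg hpr, if_neg hneg, if_neg hneg]
    simp

/-- Termwise bound with a prime-log power `log^{i+1}p`, `c = 2`: with `C` the constant of `KernelFormXSqCore.abs_coprimeSum_sub_le`,
for `p ≤ y`: `|[p prime]·log^{i+1}p·a_n(p)·S⁽²⁾(y/p;np) + 4E_n·v(p)·log^i p| ≤ [p prime]log p/(p(1+log(y/p))²)·4C·D(n)·log^i y`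
(`i = 1` is `…DiagDecorPrimeSqTerm.abs_primeSq_term_two_sub_le`). [cite: KowalskiMichelVanderKam2000, (23)–(28) — derivation] -/
theorem abs_primePow_term_two_sub_le (i : ℕ) {C : ℝ} (hC0 : 0 ≤ C)
    (hC : ∀ n : ℕ, n ≠ 0 → ∀ y : ℝ, 1 ≤ y →
      |coprimeSum n y - 2 * mainConst n| ≤ C * divWeight n / (1 + Real.log y) ^ 2)
    {n : ℕ} (hn : n ≠ 0) {y : ℝ} (hy : 1 ≤ y) {p : ℕ} (hp : p ∈ Icc 1 ⌊y⌋₊) :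
    |(if p.Prime then Real.log p ^ (i + 1) * copTauW n p *
          ∑ k ∈ Icc 1 (⌊y⌋₊ / p), copTauW (n * p) k * Real.log (y / ((p * k : ℕ) : ℝ)) ^ 2 else 0) -
        (-4 * mainConst n) *
          ((if p.Prime ∧ ¬ p ∣ n then Real.log p / ((p : ℝ) - 1) else 0) * Real.log p ^ i)| ≤
      (if p.Prime then Real.log p else 0) / ((p : ℝ) * (1 + Real.log (y / p)) ^ 2) *
        (4 * C * divWeight n * Real.log y ^ i) := by
  obtain ⟨hp0, hpy, hyp1, hlp0, hlpy, hL0, hLy⟩ := prime_range_facts hy hp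
  have hD := divWeight_nonneg n
  have hly : 0 ≤ Real.log y := Real.log_nonneg hy
  by_cases hpr : p.Prime
  · by_cases hpn : p ∣ n
    · have h0 : copTauW n p = 0 := by rw [copTauW_apply_prime hpr, if_pos hpn]
      have hneg : ¬ (p.Prime ∧ ¬ p ∣ n) := fun h ↦ h.2 hpn
      rw [if_pos hpr, if_neg hneg, if_pos hpr, h0]
      simp only [mul_zero, zero_mul, sub_zero, abs_zero]
      positivity
    · have hpos : p.Prime ∧ ¬ p ∣ n := ⟨hpr, hpn⟩
      rw [if_pos hpr, if_pos hpos, if_pos hpr, copTauW_apply_prime hpr, if_neg hpn,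
        sum_copTauW_mul_log_div_mul_pow_eq]
      have hnp : n * p ≠ 0 := mul_ne_zero hn hpr.ne_zero
      have hin := hC (n * p) hnp (y / p) hyp1
      simp only [coprimeSum] at hin
      set S := ∑ k ∈ Icc 1 ⌊y / p⌋₊, copTauW (n * p) k * Real.log (y / p / k) ^ 2 with hS
      set err := S - 2 * mainConst (n * p) with herr
      have hDnp : divWeight (n * p) ≤ 2 * divWeight n := by
        rw [mul_comm]; exact divWeight_prime_mul_le hpr hn
      have hL1 : 0 < (1 + Real.log (y / p)) ^ 2 := by positivity
      have herr_le : |err| ≤ 2 * C * divWeight n / (1 + Real.log (y / p)) ^ 2 := by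
        calc |err| ≤ C * divWeight (n * p) / (1 + Real.log (y / p)) ^ 2 := hin
          _ ≤ C * (2 * divWeight n) / (1 + Real.log (y / p)) ^ 2 := by
              gcongr
          _ = 2 * C * divWeight n / (1 + Real.log (y / p)) ^ 2 := by ring
      have hE := log_div_succ_mul_mainConst_mul hn hpr hpn
      have hp1 : (p : ℝ) + 1 ≠ 0 := by linarith
      have hSe : S = 2 * mainConst (n * p) + err := by rw [herr]; ring
      have hkey : Real.log p ^ (i + 1) * (-2 * ((p : ℝ) + 1)⁻¹) * S -
          (-4 * mainConst n) * (Real.log p / ((p : ℝ) - 1) * Real.log p ^ i) =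
          Real.log p ^ (i + 1) * (-2 * ((p : ℝ) + 1)⁻¹) * err := by
        have hE' : mainConst n * (Real.log p / ((p : ℝ) - 1)) = Real.log p * ((p : ℝ) + 1)⁻¹ * mainConst (n * p) := by
          rw [← hE]; rw [div_eq_mul_inv]
        calc _ = Real.log p ^ (i + 1) * (-2 * ((p : ℝ) + 1)⁻¹) * S +
              4 * (mainConst n * (Real.log p / ((p : ℝ) - 1))) * Real.log p ^ i := by ring
          _ = _ := by rw [hE', hSe]; ring
      rw [hkey, abs_mul, abs_mul, abs_of_nonneg (pow_nonneg hlp0 (i + 1))]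
      have habs2 : |(-2 : ℝ) * ((p : ℝ) + 1)⁻¹| = 2 * ((p : ℝ) + 1)⁻¹ := by
        rw [abs_mul, abs_inv, abs_of_pos (by linarith : (0 : ℝ) < (p : ℝ) + 1)]
        norm_num
      rw [habs2]
      have hinv : ((p : ℝ) + 1)⁻¹ ≤ ((p : ℝ))⁻¹ := by
        gcongr; linarith
      calc Real.log p ^ (i + 1) * (2 * ((p : ℝ) + 1)⁻¹) * |err|
          ≤ Real.log p ^ (i + 1) * (2 * ((p : ℝ))⁻¹) * (2 * C * divWeight n / (1 + Real.log (y / p)) ^ 2) := by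
            gcongr
        _ = Real.log p / ((p : ℝ) * (1 + Real.log (y / p)) ^ 2) * (4 * C * divWeight n * Real.log p ^ i) := by
            field_simp
            ring
        _ ≤ Real.log p / ((p : ℝ) * (1 + Real.log (y / p)) ^ 2) * (4 * C * divWeight n * Real.log y ^ i) := by
            gcongr
  · have hneg : ¬ (p.Prime ∧ ¬ p ∣ n) := fun h ↦ hpr h.1
    rw [if_neg hpr, if_neg hneg, if_neg hpr]
    simp

end Summit.Parity.GeneralizedHardyLittlewood.Theorems.MomentsBeyondDiagonal.DiagKernel

end
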